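import Literature.AlgebraicGeometry.HodgeTheory.GysinFormalismCorrespondences
import Literature.AlgebraicGeometry.HodgeTheory.SupportedHodgeClassDescent
import Literature.AlgebraicTopology.SingularHomology.GysinMapSupportProofs
import Literature.AlgebraicTopology.SingularHomology.CupProductProofs
import HarnessLib

/-!
# Composition of correspondences on `H*(–(ℂ); ℂ)` (Fulton, *Intersection Theory*, §16.1), reduced
# to Gysin base change for the product square

Family `hodge`, layer `Literature/AlgebraicGeometry/HodgeTheory`. For smooth projective complex
varieties `X, Y, Z` and classes `γ ∈ Hⁱ((X ⊗ Y)(ℂ); ℂ)`, `γ' ∈ Hʲ((Y ⊗ Z)(ℂ); ℂ)` acting as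
correspondences `[γ]_* y = fst_*(snd^* y ∪ γ)` (the shape used by the tree's statements, e.g.
`Literature.AlgebraicGeometry.Surfaces.Buskin2019_hodgeIsometry_algebraic`; `fst_*` the Gysin
morphism `complexGysin μ` of `HodgeTheory/ComplexGysin` relative to an orientation family `μ`), the
composite is the class `γ'' = p₁₃_*(p₁₂^* γ ∪ p₂₃^* γ')` on `X ⊗ Z`, where on the triple product
`X ⊗ (Y ⊗ Z)` we write `p₁₂ = X ◁ fst`, `p₂₃ = snd`, `p₁₃ = X ◁ snd`:

* W. Fulton, *Intersection Theory* (2nd ed. 1998), §16.1, Def. 16.1.1: "`β ∘ α = p_{XZ*}(p_{XY}^* α · p_{YZ}^* β)`",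
  and Prop. 16.1.1 / Def. 16.1.2 (the composite acts as the composition of the actions
  `α_*(x) = p_{Y*}(p_X^* x · α)`); the proof there is the push–pull formula for the cartesian square
  of projections (Prop. 1.7) and the projection formula.
* N. Buskin, *Every rational Hodge isometry between two K3 surfaces is algebraic*, J. reine angew.
  Math. 755 (2019), Lemma 6.3 (arXiv:1510.02852, §6.2 p. 22): "Let `α ∈ H^*(S₁ × S₂, ℚ)` and
  `β ∈ H^*(S₂ × S₃, ℚ)` be algebraic classes for smooth projective varieties `S₁, S₂, S₃`. Then the
  class `π₁₃_*(π₁₂^*(α) ∪ π₂₃^*(β)) ∈ H^*(S₁ × S₃, ℚ)` is also algebraic. Note that the pull-back of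
  an algebraic class is an algebraic class and the product of two algebraic classes is also an
  algebraic class. So the only operation in the lemma for which preservation of algebraicity is
  nontrivial is the pushforward."

## What is proved

* `corr_comp_of_baseChange_signed`, `corr_comp_of_baseChange` (even `i`) — **the composition rule
  `[c • γ'']_* = [γ]_* ∘ [γ']_*`** in all degrees, GRANTED Gysin base change up to the scalar `c` for
  the cartesian square `X ⊗ (Y ⊗ Z) → Y ⊗ Z` over `X ⊗ Y → Y`,
  `snd_{X,Y}^* ∘ (fst_{Y,Z})_* = c • (p₁₂)_* ∘ p₂₃^*` (hypothesis `hBC`; `c = 1` for the complex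
  orientations, a scalar in general since `complexGysin μ` depends on `μ` up to non-zero scalars,
  `ComplexGysinOrientation`). Proof as printed: `hBC`, the projection formula (`complexGysin_cup`)
  for `p₁₂` and `p₁₃`, functoriality (`complexGysin_comp`, `p₁₂ ≫ fst = fst = p₁₃ ≫ fst`,
  `p₁₃ ≫ snd = p₂₃ ≫ snd`), naturality, associativity and graded commutativity of `∪`
  (`cupProduct_gradedComm_holds`), which contributes the sign `(-1)^{a₁ i} (-1)^{a i}` (`= 1` for
  `i` even).
* `corrCompClass_mem_algebraicClasses` — **Buskin's Lemma 6.3 on the coniveau carriers**: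
  `γ'' ∈ Nᵉ'' H²ᵉ''` for `γ ∈ Nᵉ H²ᵉ`, `γ' ∈ Nᵉ' H²ᵉ'`, `e + e' = e'' + dim Y`, GRANTED the
  multiplicativity `Nᵉ ∪ Nᵉ' ⊆ Nᵉ⁺ᵉ'` on `X ⊗ (Y ⊗ Z)` (hypothesis `hCUP`, Voisin II Prop. 9.20, in
  the shape of the conclusion of `cupProduct_mem_algebraicClasses_of_moving`); the flat pull-backs
  (`flat_whiskerLeft_fst_left`, `map_mem_supportedClasses_of_flat_left`, the tree's
  `map_snd_mem_supportedClasses`) and the proper push-forward (the tree's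
  `complexGysin_mem_algebraicClasses` with the PROVED `gysinMap_restrictCompl_eq_zero_of_field ℂ`)
  are unconditional.

## What is NOT here

The base change `hBC` (for closed oriented manifolds and the transversal square of projections it
follows from the Künneth formula / `[M × N] = [M] × [N]`, absent for the tree's singular
(co)homology) and `hCUP` (Chow's moving lemma; cf. `AlgebraicClassesCup`,
`AlgebraicClassesExteriorProduct`) are hypotheses in the tree's vocabulary, not named facts (D-0026).
Consumer: `Surfaces/K3CorrespondenceComposition` (Buskin's Thm. 1.1 modulo Prop. 6.2, `hBC`, `hCUP`).

## References

* [Fulton1998] W. Fulton, Intersection Theory, 2nd ed., Springer 1998, §16.1 Def. 16.1.1–16.1.2,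
  Prop. 16.1.1; Prop. 1.7.
* [Buskin2019] N. Buskin, Every rational Hodge isometry between two K3 surfaces is algebraic,
  J. reine angew. Math. 755 (2019) 127–150 (arXiv:1510.02852), §6.2 Lemma 6.3.
* [FultonYoungTableaux1997] W. Fulton, Young Tableaux, CUP 1997, Appendix B §B.1 (1)–(6).
* [VoisinHodgeII2003] C. Voisin, Hodge Theory and Complex Algebraic Geometry II, CUP 2003, §9.2.4
  Prop. 9.20, Prop. 9.21.
* [Hartshorne1977] R. Hartshorne, Algebraic Geometry, III Prop. 9.2 (b), Prop. 9.5.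
* [GrothendieckTopology1969] A. Grothendieck, Hodge's general conjecture is false for trivial
  reasons, Topology 8 (1969), §1.
* [HatcherAT2002] A. Hatcher, Algebraic Topology, CUP 2002, §3.2 Prop. 3.10, Thm. 3.11.
-/

noncomputable section

open CategoryTheory AlgebraicGeometry MonoidalCategory CartesianMonoidalCategory
open Literature.AlgebraicTopology.SingularHomology

namespace Literature.AlgebraicGeometry.HodgeTheory

section HodgeTheory

variable {μ : OrientationFamily} {l m n : ℕ} {X Y Z : Motives.SchemeOver ℂ}

/-- **`p₁₂ = X ◁ pr_Y : X ⊗ (Y ⊗ Z) → X ⊗ Y` is flat**: `pr_Y : Y ⊗ Z → Y` is a base change of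
`Z → Spec ℂ` (flat over a field), and `X ◁ –` is a base change along `X ⊗ Y → Y`.
[cite: Hartshorne1977, III Prop. 9.2 (b)] -/
theorem flat_whiskerLeft_fst_left (X Y Z : Motives.SchemeOver ℂ) : Flat (X ◁ fst Y Z).left := by
  have hf : Flat (fst Y Z).left := by
    change Flat (Limits.pullback.fst Y.hom Z.hom)
    haveI : Subsingleton ↥(Spec (CommRingCat.of ℂ)) :=
      inferInstanceAs (Subsingleton (PrimeSpectrum ℂ))
    exact MorphismProperty.pullback_fst _ _ inferInstance
  rw [Over.whiskerLeft_left]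
  exact MorphismProperty.pullbackMap (MorphismProperty.id_mem (@Flat : MorphismProperty Scheme) _) hf
    (Category.id_comp _).symm (Over.w _).symm

/-- **Flat pull-back preserves the support filtration** `Nᶜ Hᵃ` (a class dying off a closed `S` of
codimension `≥ c` pulls back to one dying off `f⁻¹S`, of codimension `≥ c` as codimension does not
drop along a flat morphism, Hartshorne III Prop. 9.5); the `pr_W`/`pr_X` cases are the tree's
`map_fst_mem_supportedClasses` / `map_snd_mem_supportedClasses`.
[cite: GrothendieckTopology1969, §1] [cite: Hartshorne1977, III Prop. 9.5] -/
theorem map_mem_supportedClasses_of_flat_left {X' : Motives.SchemeOver ℂ} (f : X' ⟶ X) [Flat f.left]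
    [IsLocallyNoetherian X'.left] [IsLocallyNoetherian X.left] {a c : ℕ} {x : complexBetti X a}
    (hx : x ∈ supportedClasses X a c) :
    complexBetti.map f a x ∈ supportedClasses X' a c := by
  suffices h : supportedClasses X a c ≤
      (supportedClasses X' a c).comap (complexBetti.map f a).hom from h hx
  refine iSup_le fun S ↦ iSup_le fun hS ↦ iSup_le fun hc ↦ fun z hz ↦ ?_
  rw [LinearMap.mem_ker] at hz
  refine mem_supportedClasses_of_restrictCompl_eq_zero (hS.preimage f.left.base.hom.continuous)
    (fun w hw ↦ (hc _ hw).trans (coheight_base_le_of_flat f.left w)) ?_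
  exact complexBetti.restrictCompl_map_eq_zero f hz

/-- **The composite correspondence is algebraic** (Buskin Lemma 6.3 / Fulton Def. 16.1.1 on the
coniveau carriers): for `γ ∈ Nᵉ H²ᵉ((X ⊗ Y)(ℂ))`, `γ' ∈ Nᵉ' H²ᵉ'((Y ⊗ Z)(ℂ))` the class
`p₁₃_*(p₁₂^* γ ∪ p₂₃^* γ') ∈ Nᵉ'' H²ᵉ''((X ⊗ Z)(ℂ))`, `e + e' = e'' + dim Y`
(`p₁₂ = X ◁ fst`, `p₂₃ = snd`, `p₁₃ = X ◁ snd` on `X ⊗ (Y ⊗ Z)`), GRANTED the multiplicativity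
`Nᵉ ∪ Nᵉ' ⊆ Nᵉ⁺ᵉ'` on `X ⊗ (Y ⊗ Z)` (`hCUP`, Voisin II Prop. 9.20, in the shape of the conclusion of
`cupProduct_mem_algebraicClasses_of_moving`): the pull-backs are flat
(`flat_whiskerLeft_fst_left`, `map_snd_mem_supportedClasses`) and the proper push-forward `p₁₃_*`
preserves algebraic classes (`complexGysin_mem_algebraicClasses`, with the proved support property
`gysinMap_restrictCompl_eq_zero_of_field ℂ`). [cite: Buskin2019, Lemma 6.3]
[cite: Fulton1998, §16.1 Def. 16.1.1] [cite: VoisinHodgeII2003, §9.2.4 Prop. 9.20 and Prop. 9.21] -/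
theorem corrCompClass_mem_algebraicClasses (hμ : μ.HasPoincareDuality)
    (hX : Motives.IsSmoothProjective l X) (hY : Motives.IsSmoothProjective m Y)
    (hZ : Motives.IsSmoothProjective n Z) {e e' e'' : ℕ} (he : e + e' = e'' + m)
    (hCUP : ∀ a ∈ algebraicClasses (X ⊗ (Y ⊗ Z)) e, ∀ b ∈ algebraicClasses (X ⊗ (Y ⊗ Z)) e',
      cupProduct ((Nat.mul_add 2 e e').symm : 2 * e + 2 * e' = 2 * (e + e')) a b ∈
        algebraicClasses (X ⊗ (Y ⊗ Z)) (e + e'))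
    {γ : complexBetti (X ⊗ Y) (2 * e)} (hγ : γ ∈ algebraicClasses (X ⊗ Y) e)
    {γ' : complexBetti (Y ⊗ Z) (2 * e')} (hγ' : γ' ∈ algebraicClasses (Y ⊗ Z) e') :
    complexGysin μ (Motives.IsSmoothProjective.tensor_holds hX (Motives.IsSmoothProjective.tensor_holds hY hZ))
        (Motives.IsSmoothProjective.tensor_holds hX hZ) (X ◁ snd Y Z)
        (show 2 * (e + e') + 2 * (l + n) = 2 * e'' + 2 * (l + (m + n)) by omega)
        (cupProduct ((Nat.mul_add 2 e e').symm : 2 * e + 2 * e' = 2 * (e + e'))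
          (complexBetti.map (X ◁ fst Y Z) (2 * e) γ) (complexBetti.map (snd X (Y ⊗ Z)) (2 * e') γ')) ∈
      algebraicClasses (X ⊗ Z) e'' := by
  have hXY := Motives.IsSmoothProjective.tensor_holds hX hY
  have hYZ := Motives.IsSmoothProjective.tensor_holds hY hZ
  have hT := Motives.IsSmoothProjective.tensor_holds hX hYZ
  have ha : complexBetti.map (X ◁ fst Y Z) (2 * e) γ ∈ algebraicClasses (X ⊗ (Y ⊗ Z)) e := by
    haveI := flat_whiskerLeft_fst_left X Y Z
    haveI := Motives.IsSmoothProjective.isLocallyNoetherian_holds hXY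
    haveI := Motives.IsSmoothProjective.isLocallyNoetherian_holds hT
    exact map_mem_supportedClasses_of_flat_left (X ◁ fst Y Z) hγ
  have hb : complexBetti.map (snd X (Y ⊗ Z)) (2 * e') γ' ∈ algebraicClasses (X ⊗ (Y ⊗ Z)) e' :=
    map_snd_mem_supportedClasses hX hYZ hγ'
  exact complexGysin_mem_algebraicClasses (gysinMap_restrictCompl_eq_zero_of_field ℂ) μ hμ hT
    (Motives.IsSmoothProjective.tensor_holds hX hZ) (X ◁ snd Y Z)
    (show e + e' + (l + n) = e'' + (l + (m + n)) by omega) _ (hCUP _ ha _ hb)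

/-- **Composition of correspondences, from Gysin base change** (Fulton Prop. 16.1.1 (a) /
Def. 16.1.2; the rule `[γ'']_* = [γ]_* ∘ [γ']_*` used with Buskin's Lemma 6.3), for the actions
`[γ]_* y = fst_*(snd^* y ∪ γ)` on the complex cohomology of smooth projective `X, Y, Z` relative to an
orientation family `μ` with Poincaré duality: with `γ'' = p₁₃_*(p₁₂^* γ ∪ p₂₃^* γ')` on `X ⊗ Z`,
`[c • γ'']_* y = [γ]_*([γ']_* y)`, GRANTED base change up to the scalar `c` for the cartesian square
`X ⊗ (Y ⊗ Z) → Y ⊗ Z` over `X ⊗ Y → Y`: `snd_{X,Y}^* ∘ (fst_{Y,Z})_* = c • (X ◁ fst_{Y,Z})_* ∘ snd^*`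
(`hBC`; for the complex orientations `c = 1`). Proof: `hBC`, the projection formula
(`complexGysin_cup`) for `p₁₂` and for `p₁₃`, functoriality (`complexGysin_comp`,
`p₁₂ ≫ fst = fst = p₁₃ ≫ fst`, `p₁₃ ≫ snd = p₂₃ ≫ snd`), naturality, associativity and graded
commutativity of `∪` (`u ∪ (a ∪ b) = ± a ∪ (u ∪ b)`; the signs `(-1)^{a₁ i}` and `(-1)^{a i}` are
recorded as they come). Degrees: `y ∈ Hᵃ(Z)`, `γ ∈ Hⁱ(X ⊗ Y)`, `γ' ∈ Hʲ(Y ⊗ Z)`, `[γ']_* y ∈ H^{a₁}(Y)`,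
`[γ]_*[γ']_* y ∈ H^{a₂}(X)`, `p₁₂^*γ ∪ p₂₃^*γ' ∈ Hᵈ`, `γ'' ∈ Hᵏ(X ⊗ Z)`.
[cite: Fulton1998, §16.1 Prop. 16.1.1 and Def. 16.1.2] [cite: Buskin2019, Lemma 6.3 and proof of Thm. 1.1]
[cite: FultonYoungTableaux1997, Appendix B §B.1 (5)–(6)] -/
theorem corr_comp_of_baseChange_signed (hμ : μ.HasPoincareDuality)
    (hX : Motives.IsSmoothProjective l X) (hY : Motives.IsSmoothProjective m Y)
    (hZ : Motives.IsSmoothProjective n Z) {i j k d a a₁ a₂ : ℕ}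
    (h₁ : a + j = a₁ + 2 * n) (h₂ : a₁ + i = a₂ + 2 * m) (hk : i + j = k + 2 * m) (hd : i + j = d)
    (γ : complexBetti (X ⊗ Y) i) (γ' : complexBetti (Y ⊗ Z) j) (c : ℂ)
    (hBC : ∀ z : complexBetti (Y ⊗ Z) (a + j),
      complexBetti.map (snd X Y) a₁
        (complexGysin μ (Motives.IsSmoothProjective.tensor_holds hY hZ) hY (fst Y Z)
          (show a + j + 2 * m = a₁ + 2 * (m + n) by omega) z) =
      c • complexGysin μ
          (Motives.IsSmoothProjective.tensor_holds hX (Motives.IsSmoothProjective.tensor_holds hY hZ))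
          (Motives.IsSmoothProjective.tensor_holds hX hY) (X ◁ fst Y Z)
          (show a + j + 2 * (l + m) = a₁ + 2 * (l + (m + n)) by omega)
          (complexBetti.map (snd X (Y ⊗ Z)) (a + j) z))
    (y : complexBetti Z a) :
    complexGysin μ (Motives.IsSmoothProjective.tensor_holds hX hZ) hX (fst X Z)
        (show a + k + 2 * l = a₂ + 2 * (l + n) by omega)
        (cupProduct (rfl : a + k = a + k) (complexBetti.map (snd X Z) a y)
          (c • complexGysin μ
            (Motives.IsSmoothProjective.tensor_holds hX (Motives.IsSmoothProjective.tensor_holds hY hZ))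
            (Motives.IsSmoothProjective.tensor_holds hX hZ) (X ◁ snd Y Z)
            (show d + 2 * (l + n) = k + 2 * (l + (m + n)) by omega)
            (cupProduct hd (complexBetti.map (X ◁ fst Y Z) i γ)
              (complexBetti.map (snd X (Y ⊗ Z)) j γ')))) =
      ((-1 : ℂ) ^ (a₁ * i) * (-1 : ℂ) ^ (a * i)) •
      complexGysin μ (Motives.IsSmoothProjective.tensor_holds hX hY) hX (fst X Y)
        (show a₁ + i + 2 * l = a₂ + 2 * (l + m) by omega)
        (cupProduct (rfl : a₁ + i = a₁ + i)
          (complexBetti.map (snd X Y) a₁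
            (complexGysin μ (Motives.IsSmoothProjective.tensor_holds hY hZ) hY (fst Y Z)
              (show a + j + 2 * m = a₁ + 2 * (m + n) by omega)
              (cupProduct (rfl : a + j = a + j) (complexBetti.map (snd Y Z) a y) γ')))
          γ) := by
  -- the varieties
  have hXY := Motives.IsSmoothProjective.tensor_holds hX hY
  have hYZ := Motives.IsSmoothProjective.tensor_holds hY hZ
  have hXZ := Motives.IsSmoothProjective.tensor_holds hX hZ
  have hT := Motives.IsSmoothProjective.tensor_holds hX hYZ
  -- the inner class `z = snd^* y ∪ γ'` on `Y ⊗ Z` and its base change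
  set z : complexBetti (Y ⊗ Z) (a + j) := cupProduct rfl (complexBetti.map (snd Y Z) a y) γ' with hzdef
  set X₁ : complexBetti (X ⊗ Y) a₁ := complexGysin μ hT hXY (X ◁ fst Y Z)
    (show a + j + 2 * (l + m) = a₁ + 2 * (l + (m + n)) by omega)
    (complexBetti.map (snd X (Y ⊗ Z)) (a + j) z) with hX₁def
  have eR1 : complexBetti.map (snd X Y) a₁ (complexGysin μ hYZ hY (fst Y Z)
      (show a + j + 2 * m = a₁ + 2 * (m + n) by omega) z) = c • X₁ := hBC z
  -- `(c • X₁) ∪ γ = (-1)^{a₁ i} c • (γ ∪ X₁)`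
  have eR2 : cupProduct (rfl : a₁ + i = a₁ + i) (c • X₁) γ =
      ((-1 : ℂ) ^ (a₁ * i) * c) • cupProduct (Nat.add_comm i a₁) γ X₁ := by
    rw [map_smul, LinearMap.smul_apply, cupProduct_gradedComm_holds ℂ _ rfl (Nat.add_comm i a₁) X₁ γ,
      smul_smul, mul_comm]
  -- projection formula for `p₁₂`: `γ ∪ p₁₂_* u = p₁₂_* (p₁₂^* γ ∪ u)`
  have eR3 : cupProduct (Nat.add_comm i a₁) γ X₁ = complexGysin μ hT hXY (X ◁ fst Y Z)
      (show i + (a + j) + 2 * (l + m) = a₁ + i + 2 * (l + (m + n)) by omega)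
      (cupProduct (rfl : i + (a + j) = i + (a + j)) (complexBetti.map (X ◁ fst Y Z) i γ)
        (complexBetti.map (snd X (Y ⊗ Z)) (a + j) z)) :=
    (complexGysin_cup hμ hT hXY (X ◁ fst Y Z) rfl _ _ (Nat.add_comm i a₁) γ _).symm
  -- functoriality: `fst_* ∘ p₁₂_* = (p₁₂ ≫ fst)_* = (fst_{X, Y ⊗ Z})_*`
  have eR4 : ∀ v, complexGysin μ hXY hX (fst X Y) (show a₁ + i + 2 * l = a₂ + 2 * (l + m) by omega)
      (complexGysin μ hT hXY (X ◁ fst Y Z)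
        (show i + (a + j) + 2 * (l + m) = a₁ + i + 2 * (l + (m + n)) by omega) v) =
      complexGysin μ hT hX (fst X (Y ⊗ Z))
        (show i + (a + j) + 2 * l = a₂ + 2 * (l + (m + n)) by omega) v := by
    intro v
    rw [← LinearMap.comp_apply (f := complexGysin μ hXY hX (fst X Y) _),
      ← complexGysin_comp hμ hT hXY hX (X ◁ fst Y Z) (fst X Y)]
    simp only [whiskerLeft_fst]
  -- projection formula for `p₁₃`: `snd^* y ∪ p₁₃_* δ = p₁₃_* (p₁₃^* snd^* y ∪ δ)`
  have eL2 : cupProduct (rfl : a + k = a + k) (complexBetti.map (snd X Z) a y)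
        (complexGysin μ hT hXZ (X ◁ snd Y Z) (show d + 2 * (l + n) = k + 2 * (l + (m + n)) by omega)
          (cupProduct hd (complexBetti.map (X ◁ fst Y Z) i γ)
            (complexBetti.map (snd X (Y ⊗ Z)) j γ'))) =
      complexGysin μ hT hXZ (X ◁ snd Y Z)
        (show i + (a + j) + 2 * (l + n) = a + k + 2 * (l + (m + n)) by omega)
        (cupProduct (show a + d = i + (a + j) by omega)
          (complexBetti.map (X ◁ snd Y Z) a (complexBetti.map (snd X Z) a y))
          (cupProduct hd (complexBetti.map (X ◁ fst Y Z) i γ)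
            (complexBetti.map (snd X (Y ⊗ Z)) j γ'))) :=
    (complexGysin_cup hμ hT hXZ (X ◁ snd Y Z) _ _ _ rfl _ _).symm
  have eL3 : ∀ v, complexGysin μ hXZ hX (fst X Z) (show a + k + 2 * l = a₂ + 2 * (l + n) by omega)
      (complexGysin μ hT hXZ (X ◁ snd Y Z)
        (show i + (a + j) + 2 * (l + n) = a + k + 2 * (l + (m + n)) by omega) v) =
      complexGysin μ hT hX (fst X (Y ⊗ Z))
        (show i + (a + j) + 2 * l = a₂ + 2 * (l + (m + n)) by omega) v := by
    intro v
    rw [← LinearMap.comp_apply (f := complexGysin μ hXZ hX (fst X Z) _),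
      ← complexGysin_comp hμ hT hXZ hX (X ◁ snd Y Z) (fst X Z)]
    simp only [whiskerLeft_fst]
  -- the two classes on the triple product agree: `u ∪ (a ∪ b) = (-1)^{a i} a ∪ (u ∪ b)`
  have eE : cupProduct (show a + d = i + (a + j) by omega)
        (complexBetti.map (X ◁ snd Y Z) a (complexBetti.map (snd X Z) a y))
        (cupProduct hd (complexBetti.map (X ◁ fst Y Z) i γ) (complexBetti.map (snd X (Y ⊗ Z)) j γ')) =
      ((-1 : ℂ) ^ (a * i)) • cupProduct (rfl : i + (a + j) = i + (a + j))
        (complexBetti.map (X ◁ fst Y Z) i γ) (complexBetti.map (snd X (Y ⊗ Z)) (a + j) z) := by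
    have hu : complexBetti.map (X ◁ snd Y Z) a (complexBetti.map (snd X Z) a y) =
        complexBetti.map (snd X (Y ⊗ Z)) a (complexBetti.map (snd Y Z) a y) := by
      rw [← CategoryTheory.comp_apply, ← complexBetti.map_comp, whiskerLeft_snd, complexBetti.map_comp,
        CategoryTheory.comp_apply]
    rw [hu, hzdef, cupProduct_map]
    rw [← cupProduct_assoc (rfl : a + i = a + i) hd (show a + i + j = i + (a + j) by omega),
      cupProduct_gradedComm_holds ℂ _ (rfl : a + i = a + i) (Nat.add_comm i a) _
        (complexBetti.map (X ◁ fst Y Z) i γ),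
      map_smul, LinearMap.smul_apply,
      cupProduct_assoc (Nat.add_comm i a) rfl (show a + i + j = i + (a + j) by omega) rfl]
  -- assemble
  have hsq : ((-1 : ℂ) ^ (a₁ * i)) * ((-1 : ℂ) ^ (a₁ * i)) = 1 := by
    rw [← pow_add, ← two_mul, pow_mul, neg_one_sq, one_pow]
  rw [map_smul, map_smul, eL2, eL3, eE, map_smul, eR1, eR2, map_smul, eR3, eR4, smul_smul, smul_smul]
  congr 1
  linear_combination (-(c * (-1 : ℂ) ^ (a * i))) * hsq

/-- **Composition of correspondences of even degree, from Gysin base change** — the sign-free case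
`i = 2e` of `corr_comp_of_baseChange_signed` (the degree of an algebraic class is even):
`[c • p₁₃_*(p₁₂^* γ ∪ p₂₃^* γ')]_* y = [γ]_*([γ']_* y)`.
[cite: Fulton1998, §16.1 Prop. 16.1.1 and Def. 16.1.2] [cite: Buskin2019, Lemma 6.3 and proof of Thm. 1.1] -/
theorem corr_comp_of_baseChange (hμ : μ.HasPoincareDuality)
    (hX : Motives.IsSmoothProjective l X) (hY : Motives.IsSmoothProjective m Y)
    (hZ : Motives.IsSmoothProjective n Z) {e j k d a a₁ a₂ : ℕ}
    (h₁ : a + j = a₁ + 2 * n) (h₂ : a₁ + 2 * e = a₂ + 2 * m) (hk : 2 * e + j = k + 2 * m)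
    (hd : 2 * e + j = d)
    (γ : complexBetti (X ⊗ Y) (2 * e)) (γ' : complexBetti (Y ⊗ Z) j) (c : ℂ)
    (hBC : ∀ z : complexBetti (Y ⊗ Z) (a + j),
      complexBetti.map (snd X Y) a₁
        (complexGysin μ (Motives.IsSmoothProjective.tensor_holds hY hZ) hY (fst Y Z)
          (show a + j + 2 * m = a₁ + 2 * (m + n) by omega) z) =
      c • complexGysin μ
          (Motives.IsSmoothProjective.tensor_holds hX (Motives.IsSmoothProjective.tensor_holds hY hZ))
          (Motives.IsSmoothProjective.tensor_holds hX hY) (X ◁ fst Y Z)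
          (show a + j + 2 * (l + m) = a₁ + 2 * (l + (m + n)) by omega)
          (complexBetti.map (snd X (Y ⊗ Z)) (a + j) z))
    (y : complexBetti Z a) :
    complexGysin μ (Motives.IsSmoothProjective.tensor_holds hX hZ) hX (fst X Z)
        (show a + k + 2 * l = a₂ + 2 * (l + n) by omega)
        (cupProduct (rfl : a + k = a + k) (complexBetti.map (snd X Z) a y)
          (c • complexGysin μ
            (Motives.IsSmoothProjective.tensor_holds hX (Motives.IsSmoothProjective.tensor_holds hY hZ))
            (Motives.IsSmoothProjective.tensor_holds hX hZ) (X ◁ snd Y Z)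
            (show d + 2 * (l + n) = k + 2 * (l + (m + n)) by omega)
            (cupProduct hd (complexBetti.map (X ◁ fst Y Z) (2 * e) γ)
              (complexBetti.map (snd X (Y ⊗ Z)) j γ')))) =
      complexGysin μ (Motives.IsSmoothProjective.tensor_holds hX hY) hX (fst X Y)
        (show a₁ + 2 * e + 2 * l = a₂ + 2 * (l + m) by omega)
        (cupProduct (rfl : a₁ + 2 * e = a₁ + 2 * e)
          (complexBetti.map (snd X Y) a₁
            (complexGysin μ (Motives.IsSmoothProjective.tensor_holds hY hZ) hY (fst Y Z)
              (show a + j + 2 * m = a₁ + 2 * (m + n) by omega)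
              (cupProduct (rfl : a + j = a + j) (complexBetti.map (snd Y Z) a y) γ')))
          γ) := by
  rw [corr_comp_of_baseChange_signed hμ hX hY hZ h₁ h₂ hk hd γ γ' c hBC y]
  have h1 : ((-1 : ℂ) ^ (a₁ * (2 * e))) = 1 := by
    rw [Nat.mul_left_comm, pow_mul, neg_one_sq, one_pow]
  have h2 : ((-1 : ℂ) ^ (a * (2 * e))) = 1 := by
    rw [Nat.mul_left_comm, pow_mul, neg_one_sq, one_pow]
  rw [h1, h2, one_mul, one_smul]

end HodgeTheory

end Literature.AlgebraicGeometry.HodgeTheory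

end
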